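import Literature.MathematicalPhysics.QuantumFieldTheory.Balaban1983to89.B9Thm312WholeFromThm310L2
import Literature.MathematicalPhysics.QuantumFieldTheory.Balaban1983to89.B9RWSumsDefinitePinsPairM
import Literature.MathematicalPhysics.QuantumFieldTheory.Balaban1983to89.B9Thm310WholeDir
import Summits.QuantumFields.YangMills.Theorems.BalabanUVNodesN06G0LayerFromThm310AtPinsE
import Literature.MathematicalPhysics.QuantumFieldTheory.Balaban1983to89.B9Thm312WholeFromThm310R1A
import Literature.MathematicalPhysics.QuantumFieldTheory.Balaban1983to89.B9Thm312WholeFromThm310R1A3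
import Literature.MathematicalPhysics.QuantumFieldTheory.Balaban1983to89.B9Thm312WholeStepFrom3131
import Literature.MathematicalPhysics.QuantumFieldTheory.Balaban1983to89.B9Thm312WholeLeftStepFrom3131
import Literature.MathematicalPhysics.QuantumFieldTheory.Balaban1983to89.B9Thm312WholeFormSmallFromL2

/-!
# BalabanUVNodes ∕ N06 ([B9], `Dag.B9_main`) — THE «THEOREM 3.3 FOR G₀» LAYER, ₃ EDITION: rows 19's two-sided second-order L² family BY THE LEFT NEUMANN SERIES
# (dag-n06-w1 `B9Thm312WholeFromThm310R1A3.thm33G0L2M_of_conv3107₃`): `h36HA` reads the kinematic transpose `∀ a, IsTransposePair (Rt U a) (Rf U a)` IN PLACE OF the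
# third-order schema `FactorsL2Second310 … q3.θ3` (off print's scale, dag-n06-w1 LOCATED-SCHEMA-1); everything else — inputs, outputs, choices, proof — VERBATIM from face F
# (`g0_layer_of_thm310_coreDir`, p618914)
U-TWIN (seat `pub-ymgap-dag-n06-d` gen 15; dag-n06-l `ED47-REPLACEMENT-TABLE.md`, the option-(2) pin edition «U-dependent Hölder intermediates»): THIS FILE = the landed
`…G0LayerFromThm310AtPinsG.g0_layer_of_thm310_coreDir₃` (p641712) VERBATIM with the rows-21 Hölder intermediate `bH13` re-typed `∀ x, (bg x).Cfg → BlockNorm …`, its cost binder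
`hκ13 : ∀ x U, (bH13 x U).κ ≤ κ13`, and the two displayed inputs reading it (`hL3131H` — the Hölder sizes of `T_b, T_b₂` INTO `bH13 x U`; `hdgDH` — the mixed entry `∇_UG₀D` read into
`bH13 x U`) re-typed accordingly; the proof reads `bH13` only inside the per-member-per-configuration block (`hκB := (hκ13 x U).trans …`), so it is unchanged.  ★★ `g0_layer_of_thm310_coreDir₃U`.

Track A of `YM-PLAN.md` (cell `pub-ymgap`, HUMAN RULING D-0062), node **N06** = [Balaban1985BackgroundPropagators] Thms 3.1–3.15;
seat `pub-ymgap-dag-n06-d` (s2, «knit N06 at the ₁₁ record»), gen 12.  A HELPER for the stage-11 certificate editions ≥ 40 (the ₃ knit-swap edition).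

WHAT.  Face F (editions 33–39) derives rows 20–21's «Theorem 3.3 for G₀ = G(U)» layer from rows 19's Theorem-3.10 schemas; its (3.46)-type conclusion `Thm33G0L2M` is
read from dag-n06-c's `thm33G0L2M_of_conv3107₂`, whose input `hF3 : FactorsL2Second310 (𝔬A x) (𝔡A x) 1 (H x) q3.θ3 q.δ₀ U` (a block bound `θ₃·len⁻²` on
`K(h)·G_□M_h∇*∇*`) dag-n06-w1 LOCATED off print's scale (the true size is `θ·M⁻¹·len⁻¹·η⁻¹`; no faithful inhabitant).  Print's road (pp. 409–410, 416) is the LEFT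
Neumann series `G∇*∇* = Σₙ(Rᵀ)ⁿ·(G₀∇*∇*)`, which needs only the kinematic letter transpose `R_aᵗ = R_aᵀ` and Theorem 3.10's `Factors389` (already in `h36A`), at the
price of one more «M large» threshold `2·N_F·θ₀·√L₀·c₁ ≤ M` (p. 416 *"for M sufficiently large"*) and the doubled constant `2N₃B₃·L₀` in `B₂`.  THIS FILE is face F with
exactly: (i) `h36HA`'s conjunct `FactorsL2Second310 (𝔬A x) (𝔡A x) 1 (H x) q3.θ3 q.δ₀ U` replaced by `∀ a, IsTransposePair ((𝔬A x).Rt U a) ((𝔬A x).Rf U a)` (the ₃ faces'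
shape, `B9RWSumsDefinitePinsPairMDir3Rows.rows131819_definite_geo9Y_pairM_dir₃`); (ii) the engine call `thm33G0L2M_of_conv3107₂ … q3.θ3 … hθ3 … hF3 ↦ thm33G0L2M_of_conv3107₃ …
q.θ₀ … hq.θ₀_nn … (+ hδ₀ hα₁ (hδ5 := le_rfl) hMbig) … hf hRT` (`hf` = `h36A`'s `Factors389`); (iii) `B₂`'s second entry `secondConst … q3.θ3 … ·L₀ ↦ 2·(N₃·B₃)·L₀`; (iv) the
threshold `M₀` gains the entry `2·N_F·θ₀·√L₀·c₁(d_q, δ₀, α)`.  ★★ `g0_layer_of_thm310_coreDir₃` — statement (outputs `B12₀ Bh12 Bi12 Bi2₁₂ B12₂ θ12 θD r12 M₀ a₀`, the three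
families `hmodel12 ∕ hleft12 ∕ hG0C`) and proof otherwise IDENTICAL; face F's private arithmetic helpers are copied (private); `q3.θ3` is no longer read (only its sign
record `hq3` is kept, so the certificate's numerics witness is untouched).
HONEST FRAMING.  Kernel bookkeeping (a species re-typing of one input); COUNT-NEUTRAL; nothing of [B9] asserted — the Theorem-3.10 schemas remain displayed hypotheses about
the genuine operators; N06 NOT discharged.  One finite 𝕋⁴ programme at fixed `ε` — NOT continuum, NOT OS, NOT the mass gap ∕ Clay.  0 `def`, 0 `sorry`.
-/

noncomputable section

namespace Summit.QuantumFields.YangMills.BalabanUVNodes.N06G0LayerFromThm310GU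

open Literature.MathematicalPhysics.QuantumFieldTheory.Balaban1983to89
open Literature.MathematicalPhysics.QuantumFieldTheory.Balaban1983to89.B9Thm34Ext (toB6)
open Literature.MathematicalPhysics.QuantumFieldTheory.Balaban1983to89.B11SectG (BlockNorm HasMaj)
open Literature.MathematicalPhysics.QuantumFieldTheory.Balaban1983to89.B9Thm37Glue (IsTransposePair)
open Literature.MathematicalPhysics.QuantumFieldTheory.Balaban1983to89.B9Thm37Whole (const37)
open Literature.MathematicalPhysics.QuantumFieldTheory.Balaban1983to89.B9Thm312Whole (Thm33G0 FormSmall cNorm)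
open Literature.MathematicalPhysics.QuantumFieldTheory.Balaban1983to89.B9Thm312WholeLeft (LeftStep)
open Literature.MathematicalPhysics.QuantumFieldTheory.Balaban1983to89.B9Thm312WholeDir (Thm33G0Dir Thm33G0L2M)
open Literature.MathematicalPhysics.QuantumFieldTheory.Balaban1983to89.B9Thm313WholeDir (Thm33G0DirR)
open Literature.MathematicalPhysics.QuantumFieldTheory.Balaban1983to89.B9Thm310Whole
  (Ops310 StaticOK310 Sizes310 Local342G Identities310 Conv3107 conv3107_of_local3107)
open Literature.MathematicalPhysics.QuantumFieldTheory.Balaban1983to89.B9Thm310WholeDir (DirLetters310 Identities310₂ DirSupSq310 conv3107_of_local3107₂)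
open Literature.MathematicalPhysics.QuantumFieldTheory.Balaban1983to89.B9RWSums343Holder
  (HolderProbes HolderLegs310 FactorsHolder310 holderConst)
open Literature.MathematicalPhysics.QuantumFieldTheory.Balaban1983to89.B9RWSums344Input (inputConst44 inputConst45)
open Literature.MathematicalPhysics.QuantumFieldTheory.Balaban1983to89.B9RWSums344InputPair
  (InputLegsPair310 FactorsInputPair310 DirSupHolder310)
open Literature.MathematicalPhysics.QuantumFieldTheory.Balaban1983to89.B9RWSums346SecondDiff
  (DirOps310 DirTranspose310 L2SecondLegs310 FactorsL2Second310 secondConst secondConst_nonneg)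
open Literature.MathematicalPhysics.QuantumFieldTheory.Balaban1983to89.B9RWSums346MixedPair
  (L2MixedLegs310 FactorsL2Mixed310 DirSup310 mixedConst mixedConst_nonneg)
open Literature.MathematicalPhysics.QuantumFieldTheory.Balaban1983to89.B9RWSums346Two (L2TwoLegs310 FactorsL2_310 twoConst)
open Literature.MathematicalPhysics.QuantumFieldTheory.Balaban1983to89.B9RWSums343to347Whole (Facts347)
open Literature.MathematicalPhysics.QuantumFieldTheory.Balaban1983to89.B6RandomWalk (Ineq261 c1_nonneg)
open Literature.MathematicalPhysics.QuantumFieldTheory.Balaban1983to89.B9RWSumsDefinitePins (PinPrims)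
open Literature.MathematicalPhysics.QuantumFieldTheory.Balaban1983to89.B9RWSumsDefinitePinsPair (PairPrims)
open Literature.MathematicalPhysics.QuantumFieldTheory.Balaban1983to89.B9RWSumsDefinitePinsPairM (MixedPrims)
open Literature.MathematicalPhysics.QuantumFieldTheory.Balaban1983to89.B9RWSums347DefiniteFaces (exp261 lemma21Pack_geo9Y)
open Literature.MathematicalPhysics.QuantumFieldTheory.Balaban1983to89.B9PinMembersKLevelV1 (MemberY geo9Y)
open Literature.MathematicalPhysics.QuantumFieldTheory.Balaban1983to89.B9GeoLemma21KLevelV1 (geo9Y_len_pos)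
open Literature.MathematicalPhysics.QuantumFieldTheory.Balaban1983to89.B9Thm312WholeFromThm310
  (thm33G0_of_conv3107 leftStep_of_conv3107 thm33G0DirR_of_conv3107 thm33G0Dir_of_conv3107)
open Literature.MathematicalPhysics.QuantumFieldTheory.Balaban1983to89.B9Thm312WholeFromThm310L2 (thm33G0L2M_of_conv3107)
open Literature.MathematicalPhysics.QuantumFieldTheory.Balaban1983to89.B9Thm312WholeFromThm310R1A (thm33G0Dir_of_conv3107₂)
open Literature.MathematicalPhysics.QuantumFieldTheory.Balaban1983to89.B9Thm312WholeFromThm310R1A3 (thm33G0L2M_of_conv3107₃)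
open Literature.MathematicalPhysics.QuantumFieldTheory.Balaban1983to89.B9Thm312WholeStepFrom3131 (Letters3131 step_of_letters3131)
open Literature.MathematicalPhysics.QuantumFieldTheory.Balaban1983to89.B9Thm312WholeLeftStepFrom3131 (Letters3131H stepD_of_letters3131)
open Literature.MathematicalPhysics.QuantumFieldTheory.Balaban1983to89.B9Thm312WholeDir (StepDir)
open Literature.MathematicalPhysics.QuantumFieldTheory.Balaban1983to89.B9Thm312WholeFromThm310 (e1_of_conv3107)
open Literature.MathematicalPhysics.QuantumFieldTheory.Balaban1983to89.B9Thm312WholeFormSmallFromL2 (formSmall_of_stepL2)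
open Literature.MathematicalPhysics.QuantumFieldTheory.Balaban1983to89.B9Thm312Whole (PosDefEnd)
open Literature.MathematicalPhysics.QuantumFieldTheory.Balaban1983to89.B9Thm312Whole (GeoOK)
open Literature.MathematicalPhysics.QuantumFieldTheory.Balaban1983to89.B9GeoLemma21KLevelV1 (rowSum261_geo9Y)
open Literature.MathematicalPhysics.QuantumFieldTheory.Balaban1983to89.B11SectG (RowSum)

variable {d ℓ : ℕ} {hd : 1 ≤ d + 1} {hL : Odd (ℓ + 1) ∧ 1 < ℓ + 1} {b₀ b₁ : ℝ} {Mstar : ℕ}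
variable [∀ x : MemberY d ℓ hd hL b₀ b₁ Mstar, Fintype (geo9Y x).Site]
  [∀ x : MemberY d ℓ hd hL b₀ b₁ Mstar, DecidableEq (geo9Y x).Site]
variable {c35 : ℝ} {bg : MemberY d ℓ hd hL b₀ b₁ Mstar → B9.Backgrounds}

/-- «for M sufficiently large»: M ≧ 2N_Fθ₀c₁ gives N_F·θ₀M⁻¹·c₁ ≦ ½ (the located smallness of `conv3107_of_local3107`; the lineage's
private arithmetic, restated). [folklore] -/
private theorem small_of_threshold {NF θ₀ c M : ℝ} (hM : 0 < M) (hbig : 2 * NF * θ₀ * c ≤ M) :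
    NF * (θ₀ * M⁻¹) * c ≤ 1 / 2 := by
  have h1 : NF * (θ₀ * M⁻¹) * c = (NF * θ₀ * c) / M := by
    rw [div_eq_mul_inv]
    ring
  rw [h1, div_le_iff₀ hM]
  linarith

/-- n06-k's Hölder constant `holderConst` is ≧ 0 for nonnegative letters (its own nonnegativity lemma is private). [folklore] -/
private theorem holderConst_nonneg' {dd : ℕ} {δ₀ α NH NF C b t : ℝ} (hNH : 0 ≤ NH) (hNF : 0 ≤ NF) (hC : 0 ≤ C) (hb : 0 ≤ b)
    (ht : 0 ≤ t) : 0 ≤ holderConst dd δ₀ α NH NF C b t := by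
  have hc1 : 0 ≤ B6.c1 dd δ₀ α := c1_nonneg dd δ₀ α
  unfold holderConst
  have h1 : 0 ≤ 2 * NH * b * B6.c1 dd δ₀ α := mul_nonneg (mul_nonneg (mul_nonneg (by norm_num) hNH) hb) hc1
  have h2 : 0 ≤ NH * b := mul_nonneg hNH hb
  have h3 : 0 ≤ NF * t * C * B6.c1 dd δ₀ α := mul_nonneg (mul_nonneg (mul_nonneg hNF ht) hC) hc1
  linarith

/-- n06-k's (3.44) constant `inputConst44` is ≧ 0 for nonnegative letters. [folklore] -/
private theorem inputConst44_nonneg' {d₁ : ℕ} {δ₁ α₁ NI NF C L₀ b t : ℝ} (hNI : 0 ≤ NI) (hNF : 0 ≤ NF) (hC : 0 ≤ C)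
    (hL₀ : 0 ≤ L₀) (hb : 0 ≤ b) (ht : 0 ≤ t) : 0 ≤ inputConst44 d₁ δ₁ α₁ NI NF C L₀ b t := by
  have hc1 : 0 ≤ B6.c1 d₁ δ₁ α₁ := c1_nonneg d₁ δ₁ α₁
  unfold inputConst44
  exact add_nonneg (mul_nonneg hNI hb) (mul_nonneg (mul_nonneg (mul_nonneg hC (mul_nonneg hNF ht)) hL₀) hc1)

/-- n06-k's (3.45) constant `inputConst45` is ≧ 0 for nonnegative letters. [folklore] -/
private theorem inputConst45_nonneg' {d₁ : ℕ} {δ₁ α₁ NI NF L₀ hc b t : ℝ} (hNI : 0 ≤ NI) (hNF : 0 ≤ NF) (hL₀ : 0 ≤ L₀)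
    (hhc : 0 ≤ hc) (hb : 0 ≤ b) (ht : 0 ≤ t) : 0 ≤ inputConst45 d₁ δ₁ α₁ NI NF L₀ hc b t := by
  have hc1 : 0 ≤ B6.c1 d₁ δ₁ α₁ := c1_nonneg d₁ δ₁ α₁
  unfold inputConst45
  exact add_nonneg (mul_nonneg hNI hb) (mul_nonneg (mul_nonneg (mul_nonneg hhc (mul_nonneg hNF ht)) hL₀) hc1)

set_option maxHeartbeats 400000 in
/-- ★★ **`U`-TWIN (Hölder intermediate `bH13 x U`) OF THE ₃ G₀ LAYER** `g0_layer_of_thm310_coreDir₃` (p641712; module docstring): `h36HA`'s second-order conjunct reads `L2SecondLegs310 … q3.B3 q.δ₀ U ∧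
(∀ a, IsTransposePair ((𝔬A x).Rt U a) ((𝔬A x).Rf U a)) ∧ DirTranspose310 …` (no `FactorsL2Second310`), engine `thm33G0L2M_of_conv3107₃` (left Neumann series: `Factors389`
from `h36A`, the transpose from `h36HA`, the threshold `2·N_F·θ₀·√L₀·c₁ ≤ M` absorbed in `M₀`); output (thresholds M₀ ≥ M12, a₀ ≤ a12, constants B₀, B_h(β), B_i, B_i2,
B₂, θ₁₂, θ_D, r₁₂ ≥ 0, families `hmodel12 ∕ hleft12 ∕ hG0C` in the regime (M₀, a₀)) VERBATIM.  Nothing of print asserted.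
[cite: Balaban1985BackgroundPropagators, Thm 3.10 (3.105)–(3.108) pp.414–416 + Thm 3.3 p.399 + p.421 (G₀) + (3.42)–(3.46) pp.397–398 + Thm 3.7 ⇒ Thm 3.1 pp.409–410 (left series) +
(3.120) p.419 + (3.130)–(3.131) pp.421–422 + (3.137)–(3.138) p.423 + Thm 3.11 p.416 + Thm 3.12 p.423; Balaban1984PropagatorsII, (2.51)–(2.55) p.232 + Lemma 2.1 (2.59)–(2.61) pp.233–234] -/
theorem g0_layer_of_thm310_coreDir₃U {X Y ι A PX PY Z W : MemberY d ℓ hd hL b₀ b₁ Mstar → Type} {P : MemberY d ℓ hd hL b₀ b₁ Mstar → Type}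
    [∀ x, Fintype (X x)] [∀ x, DecidableEq (X x)] [∀ x, Fintype (Y x)] [∀ x, DecidableEq (Y x)] [∀ x, Fintype (ι x)]
    [∀ x, Fintype (A x)] [∀ x, Fintype (PX x)] [∀ x, DecidableEq (PX x)] [∀ x, Fintype (PY x)] [∀ x, DecidableEq (PY x)]
    [∀ x, Fintype (Z x)] [∀ x, Fintype (W x)] [∀ x, Fintype (P x)]
    (hc35 : 0 < c35) (q : PinPrims) (hq : q.OK) (q3 : PairPrims) (hq3 : q3.OK) (qM : MixedPrims) (hqM : qM.OK)
    (H : MemberY d ℓ hd hL b₀ b₁ Mstar → Prop)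
    -- the Theorem-3.10 letters of rows 18–19 (G side) and their schemas, VERBATIM as the certificate displays them
    (𝔬A : ∀ x : MemberY d ℓ hd hL b₀ b₁ Mstar, Ops310 (geo9Y x) (bg x) (X x) (Y x) (ι x) (A x))
    (𝔭A : ∀ x : MemberY d ℓ hd hL b₀ b₁ Mstar, HolderProbes (geo9Y x) (bg x) (X x) (Y x) (PX x) (PY x))
    (𝔡A : ∀ x : MemberY d ℓ hd hL b₀ b₁ Mstar, DirOps310 (𝔬A x) (P x)) (𝔩A : ∀ x : MemberY d ℓ hd hL b₀ b₁ Mstar, DirLetters310 (𝔬A x) (P x))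
    (bHXA : ∀ x : MemberY d ℓ hd hL b₀ b₁ Mstar, ℝ → BlockNorm (toB6 (geo9Y x) 1 (H x)) (X x → ℝ))
    (κA : MemberY d ℓ hd hL b₀ b₁ Mstar → Sizes310)
    (SHA S3A SIA SMA S2A : ∀ x : MemberY d ℓ hd hL b₀ b₁ Mstar, ι x → Finset (geo9Y x).Site)
    (hstA : ∀ x, StaticOK310 (𝔬A x) q.ρ q.Nc q.N' q.NF q.Cℓ (κA x)) (hκA : ∀ x, (κA x).Bounded q.Kc)
    (h36A : ∀ x, q.M₁ ≤ (geo9Y x).M → ∀ α₀ : ℝ, 0 < α₀ → c35 * (geo9Y x).M * α₀ ≤ q.a₁ →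
      ∀ U : (bg x).Cfg, (bg x).Reg335 c35 α₀ U →
        Local342G (𝔬A x) 1 (H x) q.B₀ q.δ₀ U ∧ B9Thm310Whole.Factors389 (𝔬A x) 1 (H x) q.θ₀ q.δ₀ U ∧
          DirSupSq310 (𝔬A x) (𝔡A x) 1 (H x) U ∧ Identities310₂ (𝔬A x) (𝔡A x) (𝔩A x) 1 (H x) U)
    (h36HA : ∀ x, q.M₁ ≤ (geo9Y x).M → ∀ α₀ : ℝ, 0 < α₀ → c35 * (geo9Y x).M * α₀ ≤ q.a₁ →
      ∀ U : (bg x).Cfg, (bg x).Reg335 c35 α₀ U →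
        HolderLegs310 (𝔬A x) (𝔭A x) 1 (H x) (SHA x) q.Bl q.δ₀ U ∧ FactorsHolder310 (𝔬A x) (𝔭A x) 1 (H x) q.Bt q.δ₀ U ∧
          (L2SecondLegs310 (𝔬A x) (𝔡A x) 1 (H x) (S3A x) q3.B3 q.δ₀ U ∧ (∀ a, IsTransposePair ((𝔬A x).Rt U a) ((𝔬A x).Rf U a)) ∧
            DirTranspose310 (𝔬A x) (𝔡A x) U) ∧
            (InputLegsPair310 (𝔬A x) (𝔡A x) (𝔭A x) 1 (H x) (bHXA x) (SIA x) q.BI q.BI2 q.δ₀ U ∧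
              FactorsInputPair310 (𝔬A x) (𝔡A x) 1 (H x) (bHXA x) q.θI q.δ₀ U ∧ DirSupHolder310 (𝔬A x) (𝔡A x) (𝔭A x) 1 (H x) U) ∧
              (L2MixedLegs310 (𝔬A x) (𝔡A x) 1 (H x) (SMA x) qM.BM q.δ₀ U ∧ FactorsL2Mixed310 (𝔬A x) (𝔡A x) 1 (H x) qM.θM q.δ₀ U ∧
                DirSup310 (𝔬A x) (𝔡A x) 1 (H x) U))
    -- the two-sided L² leg schema of Theorem 3.10 (the (3.46)₄ line of G(U) = ∇_UG∇*_U: n06-k's one-slot legs + their factors)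
    (h36A2 : ∀ x, q.M₁ ≤ (geo9Y x).M → ∀ α₀ : ℝ, 0 < α₀ → c35 * (geo9Y x).M * α₀ ≤ q.a₁ →
      ∀ U : (bg x).Cfg, (bg x).Reg335 c35 α₀ U →
        L2TwoLegs310 (𝔬A x) 1 (H x) (S2A x) q.B2 q.δ₀ U ∧ FactorsL2_310 (𝔬A x) 1 (H x) q.θ2 q.δ₀ U)
    (hcntHA : ∀ x (a : (geo9Y x).Site), (∑ c, if a ∈ SHA x c then (1 : ℝ) else 0) ≤ q.NH)
    (hcnt3A : ∀ x (a : (geo9Y x).Site), (∑ c, if a ∈ S3A x c then (1 : ℝ) else 0) ≤ q3.N3)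
    (hcntIA : ∀ x (a : (geo9Y x).Site), (∑ c, if a ∈ SIA x c then (1 : ℝ) else 0) ≤ q.NI)
    (hcntMA : ∀ x (a : (geo9Y x).Site), (∑ c, if a ∈ SMA x c then (1 : ℝ) else 0) ≤ qM.NM)
    (hcnt2A : ∀ x (a : (geo9Y x).Site), (∑ c, if a ∈ S2A x c then (1 : ℝ) else 0) ≤ q.N2)
    -- the symmetry of G(U) and the transposition (∇_UG)ᵀ = G∇*_U (theorems at the pins in the certificate)
    (hsymA : ∀ x, q.M₁ ≤ (geo9Y x).M → ∀ α₀ : ℝ, 0 < α₀ → c35 * (geo9Y x).M * α₀ ≤ q.a₁ →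
      ∀ U : (bg x).Cfg, (bg x).Reg335 c35 α₀ U → IsTransposePair ((𝔬A x).G U) ((𝔬A x).G U))
    (htrA : ∀ x, q.M₁ ≤ (geo9Y x).M → ∀ α₀ : ℝ, 0 < α₀ → c35 * (geo9Y x).M * α₀ ≤ q.a₁ →
      ∀ U : (bg x).Cfg, (bg x).Reg335 c35 α₀ U →
        IsTransposePair ((𝔬A x).D U ∘ₗ (𝔬A x).G U) ((𝔬A x).G U ∘ₗ (𝔬A x).Dstar U))
    -- the Theorem-3.12 letters of rows 20–21 and the identification G₀ := G(U) (p. 421; at def-Y's pins: the same coordinate models)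
    (𝔬12 : ∀ x : MemberY d ℓ hd hL b₀ b₁ Mstar, B9Thm312Whole.Ops (geo9Y x) (bg x) (X x) (Y x) (Z x) (W x))
    (hblk : ∀ x, (𝔬12 x).blk = (𝔬A x).blk) (hblkY : ∀ x, (𝔬12 x).blkY = (𝔬A x).blkY)
    (hG0 : ∀ x (U : (bg x).Cfg), (𝔬12 x).G0 U = (𝔬A x).G U) (hD : ∀ x (U : (bg x).Cfg), (𝔬12 x).D U = (𝔬A x).D U)
    (hDs : ∀ x (U : (bg x).Cfg), (𝔬12 x).Dstar U = (𝔬A x).Dstar U)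
    -- rows 20–21's numerics and the ONE rate relation
    (θ2₁₂ δ12₀ δK12 a12 M12 B12₃ δ12₃ t12 δT12 ρS σS κ13 : ℝ) (ha12 : 0 < a12) (hM12 : 0 < M12) (hθ2₁₂ : 0 ≤ θ2₁₂)
    (hδ12₀ : δ12₀ ≤ (1 - 3 * q.αF) * ((1 - 2 * q.α) * q.δ₀)) (hB12₃ : 0 ≤ B12₃) (ht12 : 0 ≤ t12)
    -- the Hölder block norm of the scalar fields (row 21's `bH13`) with its cutting constant bounded by κ13
    (bH13 : ∀ x : MemberY d ℓ hd hL b₀ b₁ Mstar, (bg x).Cfg → BlockNorm (toB6 (geo9Y x) 1 (H x)) (W x → ℝ)) (hκ13 : ∀ x U, (bH13 x U).κ ≤ κ13)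
    -- the rates of the derived sup-class steps: a working rate ρS ≤ δT12 with ρS + σS ≤ min(δ12₀, δ12₃) ([4] (2.61) at rate σS > 0) and δK12 + α_Fδ ≤ ρS
    (hσS : 0 < σS) (hρS : 0 ≤ ρS) (hρST : ρS ≤ δT12) (hρS₀ : ρS + σS ≤ δ12₀) (hρS₃ : ρS + σS ≤ δ12₃)
    (hδKS : δK12 + q.αF * ((1 - 2 * q.α) * q.δ₀) ≤ ρS) (hσSK : σS ≤ δK12)
    -- rows 20–21's GENUINE Sect.-D content in Theorem 3.12's regime: the steps, the form smallness, the identities, the two left steps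
    -- Theorem 3.11 for Δ_a in the model's real coordinates (from row 17's `hΔA` at the pin, `N06SectDUnitsAtPins.posDefEnd_S0coK_of_posDefTr`) and G₀Δ_a = I at the pins
    (hpos12 : ∀ x : MemberY d ℓ hd hL b₀ b₁ Mstar, M12 ≤ (geo9Y x).M → ∀ α₀ : ℝ, 0 < α₀ → (geo9Y x).M * α₀ ≤ a12 →
      ∀ U : (bg x).Cfg, (bg x).Reg335 c35 α₀ U → (bg x).Reg336 c35 α₀ U → PosDefEnd ((𝔬12 x).S0 U))
    (hinv12 : ∀ x : MemberY d ℓ hd hL b₀ b₁ Mstar, M12 ≤ (geo9Y x).M → ∀ α₀ : ℝ, 0 < α₀ → (geo9Y x).M * α₀ ≤ a12 →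
      ∀ U : (bg x).Cfg, (bg x).Reg335 c35 α₀ U → (bg x).Reg336 c35 α₀ U → (𝔬12 x).G0 U * (𝔬12 x).S0 U = 1)
    -- the Sect.-D identities GIVEN any form smallness of ratio < 1 (the certificate: def-Y's ten at the pins, the units from the form, (3.124) displayed)
    (hIdOfForm : ∀ x : MemberY d ℓ hd hL b₀ b₁ Mstar, M12 ≤ (geo9Y x).M → ∀ α₀ : ℝ, 0 < α₀ → (geo9Y x).M * α₀ ≤ a12 →
      ∀ U : (bg x).Cfg, (bg x).Reg335 c35 α₀ U → (bg x).Reg336 c35 α₀ U →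
        ∀ r : ℝ, r < 1 → FormSmall (𝔬12 x) r U → B9Thm312Whole.Identities (𝔬12 x) U)
    -- the G₀D entry of Theorem 3.3's type (the `gD2` field of row 21's `Letters313`, displayed there)
    (hgD12 : ∀ x : MemberY d ℓ hd hL b₀ b₁ Mstar, M12 ≤ (geo9Y x).M → ∀ α₀ : ℝ, 0 < α₀ → (geo9Y x).M * α₀ ≤ a12 →
      ∀ U : (bg x).Cfg, (bg x).Reg335 c35 α₀ U → (bg x).Reg336 c35 α₀ U →
        HasMaj (cNorm 1 (H x) (𝔬12 x).blkW (fun y => (geo9Y_len_pos x y).le) 1)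
          (cNorm 1 (H x) (𝔬12 x).blk (fun y => (geo9Y_len_pos x y).le) 2) ((𝔬12 x).G0 U ∘ₗ (𝔬12 x).Dv U)
          (fun a b => B12₃ * Real.exp (-(δ12₃ * (geo9Y x).dist a b))))
    -- print's (3.131) ∕ (3.137): Δ′_π = T_a + D·T_b, Δ⁽²⁾_π = T_a₂ + D·T_b₂ with small local majorants t·e^{−δ_T d} (n06-l g11 `Letters3131`; FREE letters)
    (Ta Ta₂ : ∀ x : MemberY d ℓ hd hL b₀ b₁ Mstar, (bg x).Cfg → Module.End ℝ (X x → ℝ))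
    (Tb Tb₂ : ∀ x : MemberY d ℓ hd hL b₀ b₁ Mstar, (bg x).Cfg → (X x → ℝ) →ₗ[ℝ] (W x → ℝ))
    (hL3131 : ∀ x : MemberY d ℓ hd hL b₀ b₁ Mstar, M12 ≤ (geo9Y x).M → ∀ α₀ : ℝ, 0 < α₀ → (geo9Y x).M * α₀ ≤ a12 →
      ∀ U : (bg x).Cfg, (bg x).Reg335 c35 α₀ U → (bg x).Reg336 c35 α₀ U →
        Letters3131 (𝔬12 x) (Ta x) (Ta₂ x) (Tb x) (Tb₂ x) 1 (H x) (fun y => (geo9Y_len_pos x y).le) (t12 * ((geo9Y x).M * α₀)) δT12 U)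
    -- the Hölder sizes of the derivative-carrying letters T_b, T_b₂ into `bH13` (n06-l g11 `Letters3131H`; FREE letters)
    (hL3131H : ∀ x : MemberY d ℓ hd hL b₀ b₁ Mstar, M12 ≤ (geo9Y x).M → ∀ α₀ : ℝ, 0 < α₀ → (geo9Y x).M * α₀ ≤ a12 →
      ∀ U : (bg x).Cfg, (bg x).Reg335 c35 α₀ U → (bg x).Reg336 c35 α₀ U →
        Letters3131H (𝔬12 x) (Tb x) (Tb₂ x) 1 (H x) (fun y => (geo9Y_len_pos x y).le) (bH13 x U) (t12 * ((geo9Y x).M * α₀)) δT12 U)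
    -- the mixed entry ∇_UG₀D read into `bH13` (the `dgDH` field of row 21's `Letters313D`, displayed there)
    (hdgDH12 : ∀ x : MemberY d ℓ hd hL b₀ b₁ Mstar, M12 ≤ (geo9Y x).M → ∀ α₀ : ℝ, 0 < α₀ → (geo9Y x).M * α₀ ≤ a12 →
      ∀ U : (bg x).Cfg, (bg x).Reg335 c35 α₀ U → (bg x).Reg336 c35 α₀ U →
        HasMaj (bH13 x U) (cNorm 1 (H x) (𝔬12 x).blkY (fun y => (geo9Y_len_pos x y).le) 1)
          ((𝔬12 x).D U ∘ₗ (𝔬12 x).G0 U ∘ₗ (𝔬12 x).Dv U) (fun a b => B12₃ * Real.exp (-(δ12₃ * (geo9Y x).dist a b))))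
    -- the block-L² letter of the perturbation (n06-l's `StepL2`, displayed by the certificate)
    (hstepL2 : ∀ x : MemberY d ℓ hd hL b₀ b₁ Mstar, M12 ≤ (geo9Y x).M → ∀ α₀ : ℝ, 0 < α₀ → (geo9Y x).M * α₀ ≤ a12 →
      ∀ U : (bg x).Cfg, (bg x).Reg335 c35 α₀ U → (bg x).Reg336 c35 α₀ U →
        B9Thm312WholeL2.StepL2 (𝔬12 x) 1 (H x) (θ2₁₂ * ((geo9Y x).M * α₀)) δK12 U) :
    ∃ (B12₀ : ℝ) (Bh12 Bi12 : ℝ → ℝ) (Bi2₁₂ : ℝ → ℝ → ℝ) (B12₂ θ12 θD r12 M₀ a₀ : ℝ),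
      0 ≤ B12₀ ∧ (∀ β, 0 ≤ β → β < 1 → 0 ≤ Bh12 β) ∧ (∀ ε, 0 < ε → ε ≤ 1 → 0 ≤ Bi12 ε) ∧
        (∀ ε β, 0 < ε → ε ≤ 1 → 0 ≤ β → β < 1 → 0 ≤ Bi2₁₂ ε β) ∧ 0 ≤ B12₂ ∧ 0 ≤ θ12 ∧ 0 ≤ θD ∧ 0 ≤ r12 ∧
        0 < M₀ ∧ 0 < a₀ ∧ M12 ≤ M₀ ∧ a₀ ≤ a12 ∧
        (∀ x : MemberY d ℓ hd hL b₀ b₁ Mstar, M₀ ≤ (geo9Y x).M → ∀ α₀ : ℝ, 0 < α₀ → (geo9Y x).M * α₀ ≤ a₀ →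
          ∀ U : (bg x).Cfg, (bg x).Reg335 c35 α₀ U → (bg x).Reg336 c35 α₀ U →
            Thm33G0 (𝔬12 x) 1 (H x) B12₀ δ12₀ U ∧
              B9Thm312Whole.Step (𝔬12 x) 1 (H x) (fun y => (geo9Y_len_pos x y).le) 1 (θ12 * ((geo9Y x).M * α₀)) δK12 U ∧
                B9Thm312Whole.Step (𝔬12 x) 1 (H x) (fun y => (geo9Y_len_pos x y).le) 2 (θ12 * ((geo9Y x).M * α₀)) δK12 U ∧
                  FormSmall (𝔬12 x) (r12 * ((geo9Y x).M * α₀)) U ∧ B9Thm312Whole.Identities (𝔬12 x) U) ∧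
        (∀ x : MemberY d ℓ hd hL b₀ b₁ Mstar, M₀ ≤ (geo9Y x).M → ∀ α₀ : ℝ, 0 < α₀ → (geo9Y x).M * α₀ ≤ a₀ →
          ∀ U : (bg x).Cfg, (bg x).Reg335 c35 α₀ U → (bg x).Reg336 c35 α₀ U →
            LeftStep (𝔬12 x) 1 (H x) (fun y => (geo9Y_len_pos x y).le) B12₀ δ12₀ (θD * ((geo9Y x).M * α₀)) δK12 U) ∧
        (∀ x : MemberY d ℓ hd hL b₀ b₁ Mstar, M₀ ≤ (geo9Y x).M → ∀ α₀ : ℝ, 0 < α₀ → (geo9Y x).M * α₀ ≤ a₀ →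
          ∀ U : (bg x).Cfg, (bg x).Reg335 c35 α₀ U → (bg x).Reg336 c35 α₀ U →
            Thm33G0Dir (𝔬12 x) (𝔭A x) (𝔡A x).Dd (𝔡A x).Dsd 1 (H x) (bHXA x) B12₀ Bh12 Bi12 Bi2₁₂ δ12₀ U ∧
              Thm33G0DirR (𝔬12 x) (𝔡A x).Dsd 1 (H x) B12₀ δ12₀ U ∧
                Thm33G0L2M (𝔬12 x) (𝔡A x).Dd (𝔡A x).Dsd 1 (H x) B12₂ δ12₀ U) := by
  -- [4] Lemma 2.1 (2.61) at (δ₀, α) and p. 398's member facts at ((1 − 2α)δ₀, α_F), above ONE threshold M_L (n06-i ∕ n06-k)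
  obtain ⟨ML, h261, hfacts, -⟩ :=
    lemma21Pack_geo9Y (d := d) (ℓ := ℓ) (hd := hd) (hL := hL) (b₀ := b₀) (b₁ := b₁) (Mstar := Mstar) H hq.α_pos hq.α_lt
      hq.δ₀_pos hq.αF_pos (by linarith only [hq.αF_lt])
  -- the letters of the constants
  set dq : ℕ := exp261 (@geo9Y d ℓ hd hL b₀ b₁ Mstar) q.δ₀ q.α with hdq
  set dF : ℕ := exp261 (@geo9Y d ℓ hd hL b₀ b₁ Mstar) ((1 - 2 * q.α) * q.δ₀) (1 - q.αF) with hdF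
  set L₀ : ℝ := ((ℓ + 1 : ℕ) : ℝ) with hL₀
  set C : ℝ := const37 dq q.δ₀ q.α q.ρ q.B₀ q.Nc q.N' q.Cℓ q.Kc with hCdef
  set Bh : ℝ → ℝ := fun β => holderConst dq q.δ₀ q.α q.NH q.NF C (q.Bl β) (q.Bt β) with hBh
  set Bi : ℝ → ℝ := fun ε => inputConst44 dq q.δ₀ q.α q.NI q.NF C L₀ (q.BI ε) (q.θI ε) with hBi
  set Bi2 : ℝ → ℝ → ℝ := fun ε β => inputConst45 dq q.δ₀ q.α q.NI q.NF L₀ (Bh β) (q.BI2 ε β) (q.θI (β + ε)) with hBi2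
  set B₂ : ℝ := max (max (C * L₀) (2 * (q3.N3 * q3.B3) * L₀))
    (max (mixedConst dq q.δ₀ q.α qM.NM qM.BM q.NF qM.θM C L₀) (twoConst dq q.δ₀ q.α q.N2 q.B2 q.NF q.θ2 C L₀)) with hB₂
  -- [4] (2.61) for the record geometry at the step's row-sum rate σS (n06-i `rowSum261_geo9Y`), constant `max cσ 0`
  obtain ⟨MLσ, cσ, hrow0⟩ := rowSum261_geo9Y (d := d) (ℓ := ℓ) (hd := hd) (hL := hL) (b₀ := b₀) (b₁ := b₁) (Mstar := Mstar) σS hσS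
  set c' : ℝ := max cσ 0 with hc'
  have hc'0 : 0 ≤ c' := le_max_right _ _
  have hrow : ∀ x : MemberY d ℓ hd hL b₀ b₁ Mstar, MLσ ≤ (geo9Y x).M → RowSum (toB6 (geo9Y x) 1 (H x)) σS c' :=
    fun x hM y => (hrow0 x hM y).trans (le_max_left _ _)
  set θ12 : ℝ := 2 * ((C + B12₃) * t12 * c') * L₀ with hθ12
  set θD : ℝ := 2 * ((C + max κ13 0 * B12₃) * t12 * c') with hθD
  set r12 : ℝ := θ2₁₂ * c' * (B₂ * c') with hr12
  set M₀ : ℝ := max M12 (max q.M₁ (max ML (max 1 (max (max (2 * q.NF * q.θ₀ * B6.c1 dq q.δ₀ q.α) (2 * q.NF * q.θ₀ * Real.sqrt L₀ * B6.c1 dq q.δ₀ q.α)) MLσ)))) with hM₀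
  set a₀ : ℝ := min a12 (min (q.a₁ / c35) (1 / (2 * r12 + 2))) with ha₀
  -- signs
  obtain ⟨hN3, hB3, -⟩ := hq3; obtain ⟨hNM, hBM, hθM⟩ := hqM
  have hCℓ0 : 0 ≤ q.Cℓ := zero_le_one.trans hq.one_le_Cℓ
  have hC : 0 ≤ C := B9RWSumsCompleteGeo9Y.const37_nonneg_of_signs dq hq.B₀_pos.le hq.Nc_nn hq.N'_nn hCℓ0 hq.Kc_nn
  have hL₀1 : 1 ≤ L₀ := by rw [hL₀]; exact_mod_cast Nat.succ_le_succ (Nat.zero_le _)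
  have hL₀0 : 0 ≤ L₀ := zero_le_one.trans hL₀1
  have hBh0 : ∀ β, 0 ≤ β → β < 1 → 0 ≤ Bh β := fun β hβ0 hβ1 =>
    holderConst_nonneg' hq.NH_nn hq.NF_nn hC (hq.Bl_nn β hβ0 hβ1) (hq.Bt_nn β hβ0 hβ1)
  have hBi0 : ∀ ε, 0 < ε → ε ≤ 1 → 0 ≤ Bi ε := fun ε hε hε1 =>
    inputConst44_nonneg' hq.NI_nn hq.NF_nn hC hL₀0 (hq.BI_nn ε hε hε1) (hq.θI_nn ε hε)
  have hBi20 : ∀ ε β, 0 < ε → ε ≤ 1 → 0 ≤ β → β < 1 → 0 ≤ Bi2 ε β := fun ε β hε hε1 hβ0 hβ1 =>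
    inputConst45_nonneg' hq.NI_nn hq.NF_nn hL₀0 (hBh0 β hβ0 hβ1) (hq.BI2_nn ε β hε hε1 hβ0 hβ1) (hq.θI_nn (β + ε) (by linarith))
  have hB₂0 : 0 ≤ B₂ := le_trans (mul_nonneg hC hL₀0) ((le_max_left _ _).trans (le_max_left _ _))
  have hθ12nn : 0 ≤ θ12 := mul_nonneg (mul_nonneg (by norm_num) (mul_nonneg (mul_nonneg (add_nonneg hC hB12₃) ht12) hc'0)) hL₀0
  have hθDnn : 0 ≤ θD :=
    mul_nonneg (by norm_num) (mul_nonneg (mul_nonneg (add_nonneg hC (mul_nonneg (le_max_right _ _) hB12₃)) ht12) hc'0)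
  have hr12nn : 0 ≤ r12 := mul_nonneg (mul_nonneg hθ2₁₂ hc'0) (mul_nonneg hB₂0 hc'0)
  have hM₀pos : 0 < M₀ := lt_of_lt_of_le hM12 (le_max_left _ _)
  have ha₀pos : 0 < a₀ := lt_min ha12 (lt_min (div_pos hq.a₁_pos hc35) (by positivity))
  -- the rates: δ := (1 − 2α)δ₀ > 0, δ12₀ ≤ (1 − 3α_F)δ ≤ (1 − α_F)δ ≤ δ ≤ (1 − α)δ₀
  have hδpos : 0 < (1 - 2 * q.α) * q.δ₀ := mul_pos (by linarith only [hq.α_lt]) hq.δ₀_pos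
  have hαFδ : 0 ≤ q.αF * ((1 - 2 * q.α) * q.δ₀) := mul_nonneg hq.αF_pos.le hδpos.le
  have hρ3 : δ12₀ ≤ (1 - 3 * q.αF) * ((1 - 2 * q.α) * q.δ₀) := hδ12₀
  have hρ1 : δ12₀ ≤ (1 - q.αF) * ((1 - 2 * q.α) * q.δ₀) :=
    hρ3.trans (mul_le_mul_of_nonneg_right (by linarith only [hq.αF_pos]) hδpos.le)
  have hρ0 : δ12₀ ≤ (1 - 2 * q.α) * q.δ₀ := hρ1.trans (mul_le_of_le_one_left hδpos.le (by linarith only [hq.αF_pos]))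
  have hδle : (1 - 2 * q.α) * q.δ₀ ≤ (1 - q.α) * q.δ₀ := mul_le_mul_of_nonneg_right (by linarith only [hq.α_pos]) hq.δ₀_pos.le
  have hαδ1 : q.αF * ((1 - 2 * q.α) * q.δ₀) ≤ (1 - 2 * q.α) * q.δ₀ := mul_le_of_le_one_left hδpos.le (by linarith only [hq.αF_lt])
  have hα2' : 2 * q.αF * ((1 - 2 * q.α) * q.δ₀) ≤ (1 - 2 * q.α) * q.δ₀ := mul_le_of_le_one_left hδpos.le (by linarith only [hq.αF_lt])
  have hα₁δ₀ : 0 ≤ q.α * q.δ₀ := mul_nonneg hq.α_pos.le hq.δ₀_pos.le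
  have hrate : (1 - 2 * q.αF) * ((1 - 2 * q.α) * q.δ₀) ≤ (1 - q.α) * q.δ₀ :=
    (mul_le_of_le_one_left hδpos.le (by linarith only [hq.αF_pos])).trans hδle
  refine ⟨C, Bh, Bi, Bi2, B₂, θ12, θD, r12, M₀, a₀, hC, hBh0, hBi0, hBi20, hB₂0, hθ12nn, hθDnn, hr12nn, hM₀pos, ha₀pos,
    le_max_left _ _, min_le_left _ _, fun x hM α₀ hα ha U hU hU' => ?_, fun x hM α₀ hα ha U hU hU' => ?_,
    fun x hM α₀ hα ha U hU hU' => ?_⟩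
  all_goals
    -- the member's regime: above every threshold, below both smallness bounds
    have hM12x : M12 ≤ (geo9Y x).M := le_trans (le_max_left _ _) hM
    have hMq : q.M₁ ≤ (geo9Y x).M := le_trans ((le_max_left _ _).trans (le_max_right _ _)) hM
    have hMLx : ML ≤ (geo9Y x).M := le_trans (((le_max_left _ _).trans (le_max_right _ _)).trans (le_max_right _ _)) hM
    have hM1 : 1 ≤ (geo9Y x).M :=
      le_trans ((((le_max_left _ _).trans (le_max_right _ _)).trans (le_max_right _ _)).trans (le_max_right _ _)) hM
    have hbig : 2 * q.NF * q.θ₀ * B6.c1 dq q.δ₀ q.α ≤ (geo9Y x).M :=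
      le_trans ((((((le_max_left _ _).trans (le_max_left _ _)).trans (le_max_right _ _)).trans (le_max_right _ _)).trans
        (le_max_right _ _)).trans (le_max_right _ _)) hM
    have hMbig : 2 * q.NF * q.θ₀ * Real.sqrt L₀ * B6.c1 dq q.δ₀ q.α ≤ (geo9Y x).M :=
      le_trans ((((((le_max_right _ _).trans (le_max_left _ _)).trans (le_max_right _ _)).trans (le_max_right _ _)).trans
        (le_max_right _ _)).trans (le_max_right _ _)) hM
    have hMLσx : MLσ ≤ (geo9Y x).M :=
      le_trans (((((le_max_right _ _).trans (le_max_right _ _)).trans (le_max_right _ _)).trans (le_max_right _ _)).trans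
        (le_max_right _ _)) hM
    have hMpos : 0 < (geo9Y x).M := lt_of_lt_of_le one_pos hM1
    have ha12x : (geo9Y x).M * α₀ ≤ a12 := ha.trans (min_le_left _ _)
    have haq : c35 * (geo9Y x).M * α₀ ≤ q.a₁ := by
      have h1 : c35 * ((geo9Y x).M * α₀) ≤ c35 * (q.a₁ / c35) :=
        mul_le_mul_of_nonneg_left (ha.trans ((min_le_right _ _).trans (min_le_left _ _))) hc35.le
      rw [mul_div_cancel₀ _ hc35.ne'] at h1
      simpa only [mul_assoc] using h1
    have hq' : q.NF * (q.θ₀ * (geo9Y x).M⁻¹) * B6.c1 dq q.δ₀ q.α ≤ 1 / 2 := small_of_threshold hMpos hbig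
    have hlen : ∀ y : (geo9Y x).Site, 0 ≤ (geo9Y x).len y := fun y => (geo9Y_len_pos x y).le
    obtain ⟨hl, hf, hTd, hi⟩ := h36A x hMq α₀ hα haq U hU
    obtain ⟨hL, hFH, ⟨hL3, hRT, hDT⟩, ⟨hIL, hFI, hDH⟩, ⟨hLM, hFM, hDS⟩⟩ := h36HA x hMq α₀ hα haq U hU
    obtain ⟨hL2, hF2⟩ := h36A2 x hMq α₀ hα haq U hU
    have hc : Conv3107 (𝔬A x) 1 (H x) C ((1 - 2 * q.α) * q.δ₀) U :=
      conv3107_of_local3107₂ (𝔬A x) (𝔡A x) (𝔩A x) 1 (H x) dq q.δ₀ q.α q.ρ q.B₀ q.Nc q.N' q.NF q.Cℓ q.Kc q.θ₀ (κA x) U hq.B₀_pos.le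
        hq.δ₀_pos.le hq.α_pos.le hq.α_lt.le hq.Nc_nn hq.N'_nn hq.NF_nn hq.one_le_Cℓ hq.Kc_nn hq.θ₀_nn hMpos (hstA x) (hκA x)
        (h261 x hMLx) hq' hl hf hTd hi
    have hgeo : GeoOK (geo9Y x) := ⟨(hstA x).tri, (hstA x).symm, (hstA x).dnn, (hstA x).lenpos⟩
    have hMα : 0 ≤ (geo9Y x).M * α₀ := mul_nonneg hMpos.le hα.le
    have hL2M := thm33G0L2M_of_conv3107₃ (𝔬12 x) (𝔬A x) (𝔡A x) (𝔩A x) dF dq ((1 - 2 * q.α) * q.δ₀) q.αF L₀ q.δ₀ q.α q.ρ q.Nc q.N' q.NF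
        q.Cℓ q.N2 q.B2 q.θ2 q3.N3 q3.B3 q.θ₀ qM.NM qM.BM qM.θM C B₂ δ12₀ (κA x) (S2A x) (S3A x) (SMA x) U (hblk x) (hblkY x)
        (hG0 x U) (hD x U) (hDs x U) hq.NF_nn hq.N2_nn hq.B2_nn hq.θ2_nn hN3 hB3 hq.θ₀_nn hNM hBM hθM hM1 hC hαFδ hα2' hα₁δ₀ hrate
        hq.δ₀_pos.le hq.α_pos.le le_rfl hMbig
        ((le_max_left _ _).trans (le_max_left _ _)) ((le_max_right _ _).trans (le_max_left _ _))
        ((le_max_left _ _).trans (le_max_right _ _)) ((le_max_right _ _).trans (le_max_right _ _)) hρ3 (hstA x) (hcnt2A x)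
        (hcnt3A x) (hcntMA x) (h261 x hMLx) (hfacts x hMLx) hi hL2 hF2 hL3 hf hRT hLM hFM hDS hDT (hsymA x hMq α₀ hα haq U hU)
        (htrA x hMq α₀ hα haq U hU) hc
    -- the form smallness (n06-l g12 `formSmall_of_stepL2`) with r12 := θ₂·c·(B₂·c), then the identities given it (ratio r12·Mα₀ < 1 by a₀)
    have hσ0 : σS ≤ δ12₀ := le_trans (le_add_of_nonneg_left hρS) hρS₀
    have hsym0 : IsTransposePair ((𝔬12 x).G0 U) ((𝔬12 x).G0 U) := by rw [hG0 x U]; exact hsymA x hMq α₀ hα haq U hU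
    have hform : FormSmall (𝔬12 x) (r12 * ((geo9Y x).M * α₀)) U :=
      formSmall_of_stepL2 (R₀ := 1) (H₀ := H x) hgeo (hrow x hMLσx) hc'0 hσ0 hσSK hB₂0 (mul_nonneg hθ2₁₂ hMα)
        (le_of_eq (by rw [hr12]; ring)) hsym0 (hpos12 x hM12x α₀ hα ha12x U hU hU') (hinv12 x hM12x α₀ hα ha12x U hU hU') hL2M.l0
        (hstepL2 x hM12x α₀ hα ha12x U hU hU')
    have hr1 : r12 * ((geo9Y x).M * α₀) < 1 := by
      have ha3 : (geo9Y x).M * α₀ ≤ 1 / (2 * r12 + 2) := ha.trans ((min_le_right _ _).trans (min_le_right _ _))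
      have h2 : 0 < 2 * r12 + 2 := by positivity
      calc r12 * ((geo9Y x).M * α₀) ≤ r12 * (1 / (2 * r12 + 2)) := mul_le_mul_of_nonneg_left ha3 hr12nn
        _ < 1 := by rw [mul_one_div, div_lt_one h2]; linarith
    have hrest12 := And.intro hform (hIdOfForm x hM12x α₀ hα ha12x U hU hU' _ hr1 hform)
  · have h33 : Thm33G0 (𝔬12 x) 1 (H x) C δ12₀ U :=
      thm33G0_of_conv3107 (𝔬12 x) (𝔬A x) (hblk x) (hblkY x) (hG0 x U) (hDs x U) hC hρ0 (hstA x).dnn hlen hc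
    have hθ : 2 * ((C + B12₃) * (t12 * ((geo9Y x).M * α₀)) * c') * L₀ ≤ θ12 * ((geo9Y x).M * α₀) :=
      le_of_eq (by rw [hθ12]; ring)
    have hst := step_of_letters3131 (R₀ := 1) (H₀ := H x) hgeo (hfacts x hMLx) (hrow x hMLσx) hc'0 hC hB12₃ (mul_nonneg ht12 hMα)
      hρS hρST hρS₀ hρS₃ hαFδ hθ hδKS h33 (hgD12 x hM12x α₀ hα ha12x U hU hU') (hL3131 x hM12x α₀ hα ha12x U hU hU')
    exact ⟨h33, hst.1, hst.2, hrest12⟩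
  · -- (3.42)₂ for G₀ from `Conv3107`, then the two left steps from the letters (n06-l g11 `stepD_of_letters3131`) at θ_D := max(θD12, 2(B₀ + κ13B₃)t·c)
    have he1 := e1_of_conv3107 (𝔬12 x) (𝔬A x) (hblk x) (hblkY x) (hG0 x U) (hD x U) hC hρ0 (hstA x).dnn hlen hc
    have hκB : (bH13 x U).κ * B12₃ ≤ max κ13 0 * B12₃ := mul_le_mul_of_nonneg_right ((hκ13 x U).trans (le_max_left _ _)) hB12₃
    have h1 : (C + (bH13 x U).κ * B12₃) * (t12 * ((geo9Y x).M * α₀)) * c' ≤ (C + max κ13 0 * B12₃) * (t12 * ((geo9Y x).M * α₀)) * c' :=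
      mul_le_mul_of_nonneg_right (mul_le_mul_of_nonneg_right ((add_le_add_iff_left C).mpr hκB) (mul_nonneg ht12 hMα)) hc'0
    have hθ : 2 * ((C + (bH13 x U).κ * B12₃) * (t12 * ((geo9Y x).M * α₀)) * c') ≤ θD * ((geo9Y x).M * α₀) :=
      calc 2 * ((C + (bH13 x U).κ * B12₃) * (t12 * ((geo9Y x).M * α₀)) * c')
          ≤ 2 * ((C + max κ13 0 * B12₃) * (t12 * ((geo9Y x).M * α₀)) * c') := mul_le_mul_of_nonneg_left h1 (by norm_num)
        _ = θD * ((geo9Y x).M * α₀) := by rw [hθD]; ring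
    have hδK : δK12 ≤ ρS := le_trans (le_add_of_nonneg_right hαFδ) hδKS
    obtain ⟨hsd, hsd1⟩ := stepD_of_letters3131 (R₀ := 1) (H₀ := H x) hgeo (hrow x hMLσx) hc'0 hC hB12₃ (mul_nonneg ht12 hMα) hρS
      hρST hρS₀ hρS₃ hθ hδK he1 (hdgDH12 x hM12x α₀ hα ha12x U hU hU') (hL3131 x hM12x α₀ hα ha12x U hU hU')
      (hL3131H x hM12x α₀ hα ha12x U hU hU')
    exact ⟨he1, hsd, hsd1⟩
  · refine ⟨?_, thm33G0DirR_of_conv3107 (𝔬12 x) (𝔬A x) (𝔡A x) (hblk x) (hG0 x U) hC hρ0 (hstA x).dnn hlen hc hDS, ?_⟩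
    · exact thm33G0Dir_of_conv3107₂ (𝔬12 x) (𝔬A x) (𝔡A x) (𝔩A x) (𝔭A x) (bHXA x) dF dq ((1 - 2 * q.α) * q.δ₀) q.αF L₀ q.δ₀ q.α q.ρ
        q.Nc q.N' q.NF q.Cℓ q.θ₀ q.NH q.NI C δ12₀ (κA x) (SHA x) (SIA x) q.Bl q.Bt q.BI q.θI q.BI2 U (hblk x) (hblkY x) (hG0 x U)
        (hD x U) (hDs x U) hq.δ₀_pos.le hq.α_pos.le (by linarith only [hq.α_lt]) hq.NF_nn hq.θ₀_nn hq.NH_nn hq.NI_nn hM1 hC hδpos.le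
        hδle hαFδ hαδ1 hρ1 hq.Bl_nn hq.Bt_nn hq.BI_nn hq.BI2_nn hq.θI_nn (hstA x) (hcntHA x) (hcntIA x) (h261 x hMLx) hq'
        (hfacts x hMLx) hf hi hL hFH hIL hFI hDS hDH hc
    · exact hL2M

end Summit.QuantumFields.YangMills.BalabanUVNodes.N06G0LayerFromThm310GU

end
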